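import Mathlib
import Literature.Analysis.FluidPDE.VectorCalculus
import Literature.Analysis.ODE.LinearOpenInterval
import Summits.NavierStokesRegularity.NavierStokesRegularity.Theorems.FilamentSkeletonRssClause13RAdjointWaistSourced

/-!
# Clause 13-R, STUB R at MODEL level: EXISTENCE of the bounded waist-regular branch of the SOURCED local adjoint equation
# (census item (R-c′-E), local half; crux `Clause13RNearStraightL`, stmt-NavierStokesRegularity-23612; line `rate_bordered_split`,
# STUB R `stub_rateRow13RFlat`)

Route `FilamentSkeletonRss`, Variant A1R.  The density of an annihilating edge measure of the MODEL linearised operator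
(`…Clause13REdgeMeasureModel` p829163, `…Clause13RAdjointStraightModelWeights`) solves, near the stagnation point `c` of the slip `w`
(`w(c) = 0`, `w′(c) ≥ 3/2 + δ`), the SOURCED local adjoint equation
  `w σ φ′ σ + (½ + w′ σ) φ σ + α e × φ σ + cst·m σ (φ σ × d) = g σ`,
`g` collecting the (bounded, continuous) nonlocal term and the edge-atom kernels.  On the tree the waist-regular branch of this equation is
UNIQUE and BOUNDED BY THE SOURCE (`…Clause13RAdjointWaistSourced` p831138: `w(σ)‖φ(σ)‖ ≤ G(σ − c)`, `‖φ‖ ≤ G/κ₁`), every other branch blows up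
like `1/w` and carries no finite measure (`…WaistIntegrable` p831266), and in the punctured bounded class the density of the full (nonlocal) sourced
equation is unique (`…AdjointPuncturedUnique` p832285) and `L²`-bounded by its atoms (`…PuncturedApriori` p832351).  What the exit reports of hands
fsrs-19-g1 / fsrs-22 / fsrs-23 list as the remaining MODEL item (R-c′-E) is EXISTENCE.  THIS FILE proves its local half:

* `exists_solution_affine_of_continuousOn_Ioo` — inhomogeneous linear equations `v′ = A(t)v + b(t)` with `A, b` continuous on an open interval have
  solutions on the WHOLE interval through any point (the tree's `Literature.Analysis.ODE.exists_solution_linear_of_continuousOn_Ioo`, Hartman Ch. IV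
  Lemma 1.1, applied to the state augmented by a constant component);
* `exists_waistRegular_branch_right` — **on a right half-ball `(c, σ₂)` where the slip opens at least linearly, `κ₁(s − c) ≤ w(s)` (`κ₁ > 0`), the
  sourced local adjoint equation HAS a solution `φ`, differentiable on `(c, σ₂)`, which is waist-regular and bounded by the source alone:
  `w(s)‖φ(s)‖ ≤ G(s − c)` and `‖φ(s)‖ ≤ G/κ₁`** (`G = sup‖g‖` on `[c, σ₂]`).  Construction: solve the regular linear equation on `(c, σ₂)` with
  `φₙ(c + ηₙ) = 0`, `ηₙ ↓ 0`; the sourced waist law gives `w‖φₙ‖ ≤ G(s − c)` and, for the difference of two approximants (a solution of the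
  homogeneous equation), `w(s)‖φₙ(s) − φₖ(s)‖ ≤ G ηₙ` (`k ≥ n`): the approximants converge, uniformly on every `[c + δ, σ₂)`, together with their
  derivatives, and the limit solves the equation (`hasDerivAt_of_tendstoUniformlyOn`).

With p831138 (uniqueness) this is the complete local theory of the waist-regular branch right of the waist; the mirror statement left of the waist
follows by the reflection `s ↦ 2c − s`, `w ↦ −w(2c − ·)` (`exists_waistRegular_branch_left`).  Planner-facing: the GLOBAL half of (R-c′-E) (the
nonlocal term, a compact perturbation; uniqueness p832285) is a Fredholm-alternative step, and the Fredholm alternative for compact operators IS in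
Mathlib (`IsCompactOperator.hasEigenvalue_or_mem_resolventSet`, `Mathlib/Analysis/Normed/Operator/Compact/FredholmAlternative.lean`) — it is not
the library gap earlier exit reports recorded.  [folklore] (variation of constants / a-priori-bound-and-limit at a transport stagnation point).
Hand `leafhand-ns-filamentskeletonrs-25-g0` (LAND-ONLY); `--supports stmt-NavierStokesRegularity-23612` helper, def-free.  HONEST FRAMING: an ODE
existence statement for the MODEL adjoint equation attached to a HYPOTHETICAL filament skeleton on the NEGATIVE side of a MODEL blow-up route;
STUB R is NOT proved here and nothing in this file bears on Navier–Stokes regularity or blow-up.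
-/

noncomputable section

open MeasureTheory Filter Topology Set Metric
open scoped RealInnerProductSpace InnerProductSpace
open Literature.Analysis.FluidPDE
open Summit.NavierStokesRegularity.NavierStokesRegularity.Theorems.Clause13RAdjointWaistSourced (wnorm_le_of_sourced_right)

namespace Summit.NavierStokesRegularity.NavierStokesRegularity.Theorems.Clause13RAdjointWaistExistence
set_option linter.dupNamespace false

/-! ## §1 Inhomogeneous linear equations on an open interval -/

/-- A function with zero derivative on an open interval is constant there (value at a base point). [folklore] -/
theorem eq_of_hasDerivAt_zero_Ioo {F : Type*} [NormedAddCommGroup F] [NormedSpace ℝ F] {r : ℝ → F} {lo hi τ₀ : ℝ}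
    (hτ₀ : τ₀ ∈ Ioo lo hi) (hr : ∀ t ∈ Ioo lo hi, HasDerivAt r 0 t) : ∀ t ∈ Ioo lo hi, r t = r τ₀ := by
  intro t ht
  rcases le_total τ₀ t with hle | hle
  · have hsub : Icc τ₀ t ⊆ Ioo lo hi := fun x hx => ⟨lt_of_lt_of_le hτ₀.1 hx.1, lt_of_le_of_lt hx.2 ht.2⟩
    exact constant_of_has_deriv_right_zero (fun x hx => (hr x (hsub hx)).continuousAt.continuousWithinAt)
      (fun x hx => (hr x (hsub ⟨hx.1, hx.2.le⟩)).hasDerivWithinAt) t ⟨hle, le_rfl⟩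
  · have hsub : Icc t τ₀ ⊆ Ioo lo hi := fun x hx => ⟨lt_of_lt_of_le ht.1 hx.1, lt_of_le_of_lt hx.2 hτ₀.2⟩
    exact (constant_of_has_deriv_right_zero (fun x hx => (hr x (hsub hx)).continuousAt.continuousWithinAt)
      (fun x hx => (hr x (hsub ⟨hx.1, hx.2.le⟩)).hasDerivWithinAt) τ₀ ⟨hle, le_rfl⟩).symm

set_option maxHeartbeats 400000 in
/-- **Inhomogeneous linear equations live on the whole interval of continuity of the data.**  `A : ℝ → L(F, F)` and `b : ℝ → F` continuous on
`(lo, hi)`, `τ₀ ∈ (lo, hi)`, `x₀ ∈ F`: there is `v` with `v(τ₀) = x₀` and `v′(t) = A(t) v(t) + b(t)` at every `t ∈ (lo, hi)` (augment the state by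
a constant component and apply `Literature.Analysis.ODE.exists_solution_linear_of_continuousOn_Ioo`). [folklore] -/
theorem exists_solution_affine_of_continuousOn_Ioo {F : Type*} [NormedAddCommGroup F] [NormedSpace ℝ F] [CompleteSpace F]
    {A : ℝ → F →L[ℝ] F} {b : ℝ → F} {lo hi τ₀ : ℝ} (hτ₀ : τ₀ ∈ Ioo lo hi)
    (hA : ContinuousOn A (Ioo lo hi)) (hb : ContinuousOn b (Ioo lo hi)) (x₀ : F) :
    ∃ v : ℝ → F, v τ₀ = x₀ ∧ ∀ t ∈ Ioo lo hi, HasDerivAt v (A t (v t) + b t) t := by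
  -- the augmented coefficient on `F × ℝ`: `(x, r) ↦ (A t x + r • b t, 0)`
  set T : ℝ → (F × ℝ) →L[ℝ] F := fun t =>
    (A t).comp (ContinuousLinearMap.fst ℝ F ℝ) + (ContinuousLinearMap.snd ℝ F ℝ).smulRight (b t) with hT
  set Baug : ℝ → (F × ℝ) →L[ℝ] (F × ℝ) := fun t => (T t).prod 0 with hBaug
  have hBaug_apply : ∀ t (p : F × ℝ), Baug t p = (A t p.1 + p.2 • b t, 0) := by
    intro t p
    simp only [hBaug, hT, ContinuousLinearMap.prod_apply, add_apply, ContinuousLinearMap.coe_comp,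
      Function.comp_apply, ContinuousLinearMap.coe_fst', ContinuousLinearMap.smulRight_apply, ContinuousLinearMap.coe_snd',
      zero_apply]
  have hTc : ContinuousOn T (Ioo lo hi) := by
    have h1 : ContinuousOn (fun t => (A t).comp (ContinuousLinearMap.fst ℝ F ℝ)) (Ioo lo hi) :=
      hA.clm_comp continuousOn_const
    have h2 : ContinuousOn (fun t => (ContinuousLinearMap.snd ℝ F ℝ).smulRight (b t)) (Ioo lo hi) :=
      (isBoundedBilinearMap_smulRight (𝕜 := ℝ) (E := F × ℝ) (F := F)).continuous.comp_continuousOn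
        (continuousOn_const.prodMk hb)
    exact h1.add h2
  have hBc : ContinuousOn Baug (Ioo lo hi) :=
    (ContinuousLinearMap.prodₗᵢ ℝ).continuous.comp_continuousOn (hTc.prodMk continuousOn_const)
  obtain ⟨V, hV0, hV⟩ := Literature.Analysis.ODE.exists_solution_linear_of_continuousOn_Ioo hτ₀ hBc (x₀, (1 : ℝ))
  -- the second component is constant `= 1`
  have h2 : ∀ t ∈ Ioo lo hi, (V t).2 = 1 := by
    have hd : ∀ t ∈ Ioo lo hi, HasDerivAt (fun s => (V s).2) 0 t := by
      intro t ht
      have h := (ContinuousLinearMap.snd ℝ F ℝ).hasFDerivAt.comp_hasDerivAt t (hV t ht)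
      have hval : (ContinuousLinearMap.snd ℝ F ℝ) (Baug t (V t)) = 0 := by
        rw [hBaug_apply]; rfl
      rw [hval] at h
      exact h
    intro t ht
    have h := eq_of_hasDerivAt_zero_Ioo hτ₀ hd t ht
    simp only [hV0] at h
    exact h
  refine ⟨fun t => (V t).1, by simp only [hV0], fun t ht => ?_⟩
  have h := (ContinuousLinearMap.fst ℝ F ℝ).hasFDerivAt.comp_hasDerivAt t (hV t ht)
  have hval : (ContinuousLinearMap.fst ℝ F ℝ) (Baug t (V t)) = A t (V t).1 + b t := by
    rw [hBaug_apply, h2 t ht, one_smul]; rfl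
  rw [hval] at h
  exact h

/-! ## §2 The local adjoint field and its algebra -/

/-- The linear part of the local adjoint field at a station `s` (meaningful where `w s ≠ 0`):
`x ↦ (w s)⁻¹ • (−(½ + w′ s) x − α e × x − cst·m s (x × d))`, as a continuous linear map (inline, no definition). [folklore] -/
theorem localField_apply (w w' m : ℝ → ℝ) (α cst : ℝ) (d e : EuclideanSpace ℝ (Fin 3)) (s : ℝ) (x : EuclideanSpace ℝ (Fin 3)) :
    ((w s)⁻¹ • (-((1 / 2 + w' s) • ContinuousLinearMap.id ℝ (EuclideanSpace ℝ (Fin 3))) - α • crossCLM e - (cst * m s) • crossCLM.flip d)) x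
      = (w s)⁻¹ • (-((1 / 2 + w' s) • x) - α • cross e x - (cst * m s) • cross x d) := by
  simp only [smul_apply, sub_apply, neg_apply,
    ContinuousLinearMap.id_apply, crossCLM_apply, ContinuousLinearMap.flip_apply]

/-- From the explicit derivative `φ′ = (w)⁻¹ • (g − (½ + w′)φ − α e × φ − cst·m (φ × d))` back to the sourced local adjoint equation
(where `w ≠ 0`). [folklore] -/
theorem sourced_eq_of_deriv_eq {wv wp α cm : ℝ} (hw : wv ≠ 0) {x y gx : EuclideanSpace ℝ (Fin 3)} {d e : EuclideanSpace ℝ (Fin 3)}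
    (h : y = wv⁻¹ • (-((1 / 2 + wp) • x) - α • cross e x - cm • cross x d) + wv⁻¹ • gx) :
    wv • y + (1 / 2 : ℝ) • x + wp • x + α • cross e x + cm • cross x d = gx := by
  rw [h, smul_add, smul_smul, smul_smul, mul_inv_cancel₀ hw, one_smul, one_smul, add_smul]
  abel

/-- The difference of two solutions of the sourced local adjoint equation (same source) solves the homogeneous one. [folklore] -/
theorem homogeneous_of_sub {wv wp α cm : ℝ} {x₁ y₁ x₂ y₂ gx : EuclideanSpace ℝ (Fin 3)} {d e : EuclideanSpace ℝ (Fin 3)}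
    (h₁ : wv • y₁ + (1 / 2 : ℝ) • x₁ + wp • x₁ + α • cross e x₁ + cm • cross x₁ d = gx)
    (h₂ : wv • y₂ + (1 / 2 : ℝ) • x₂ + wp • x₂ + α • cross e x₂ + cm • cross x₂ d = gx) :
    wv • (y₁ - y₂) + (1 / 2 : ℝ) • (x₁ - x₂) + wp • (x₁ - x₂) + α • cross e (x₁ - x₂) + cm • cross (x₁ - x₂) d
      = (fun _ => (0 : EuclideanSpace ℝ (Fin 3))) wv := by
  have hc1 : cross e (x₁ - x₂) = cross e x₁ - cross e x₂ := by
    rw [← crossCLM_apply, map_sub]; rfl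
  have hc2 : cross (x₁ - x₂) d = cross x₁ d - cross x₂ d := by
    rw [← crossCLM_apply, map_sub, sub_apply]; rfl
  rw [hc1, hc2]
  have h := congrArg₂ (· - ·) h₁ h₂
  simp only [sub_self] at h
  rw [← h]
  simp only [smul_sub]
  abel

/-! ## §3 Existence of the waist-regular branch, right of the waist -/

set_option maxHeartbeats 400000 in
/-- **EXISTENCE OF THE BOUNDED WAIST-REGULAR BRANCH (right half-ball).**  Slip `w ∈ C¹(ℝ)` (`w′` continuous) opening at least linearly to the
right of the stagnation point, `κ₁(s − c) ≤ w(s)` on `[c, σ₂]` (`κ₁ > 0`, `c < σ₂`); continuous weight `m` and source `g` with `‖g‖ ≤ G` on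
`[c, σ₂]`; constants `α, cst`, vectors `d, e`.  Then the sourced local adjoint equation
`w φ′ + ½φ + w′φ + α e × φ + cst·m (φ × d) = g` has a solution on the open half-ball `(c, σ₂)` — `φ` differentiable there with derivative `φ′` —
which is WAIST-REGULAR, `w(s)‖φ(s)‖ ≤ G(s − c)`, hence bounded by the source alone, `‖φ(s)‖ ≤ G/κ₁`.  (It is the unique such branch by
`…Clause13RAdjointWaistSourced.waistRegular_unique_right`.) [folklore] -/
theorem exists_waistRegular_branch_right {c σ₂ κ₁ G α cst : ℝ} {m w w' : ℝ → ℝ} {g : ℝ → EuclideanSpace ℝ (Fin 3)}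
    {d e : EuclideanSpace ℝ (Fin 3)} (hcσ : c < σ₂) (hκ₁ : 0 < κ₁)
    (hw : ∀ s, HasDerivAt w (w' s) s) (hw'c : Continuous w') (hm : Continuous m) (hg : Continuous g)
    (hwlow : ∀ s ∈ Icc c σ₂, κ₁ * (s - c) ≤ w s) (hG : ∀ s ∈ Icc c σ₂, ‖g s‖ ≤ G) :
    ∃ φ φ' : ℝ → EuclideanSpace ℝ (Fin 3),
      (∀ s ∈ Ioo c σ₂, HasDerivAt φ (φ' s) s) ∧
      (∀ s ∈ Ioo c σ₂, w s • φ' s + (1 / 2 : ℝ) • φ s + w' s • φ s + α • cross e (φ s) + (cst * m s) • cross (φ s) d = g s) ∧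
      (∀ s ∈ Ioo c σ₂, w s * ‖φ s‖ ≤ G * (s - c)) ∧
      (∀ s ∈ Ioo c σ₂, ‖φ s‖ ≤ G / κ₁) := by
  -- positivity of the slip on the open half-ball
  have hwpos : ∀ s ∈ Ioo c σ₂, 0 < w s := fun s hs =>
    lt_of_lt_of_le (mul_pos hκ₁ (by linarith [hs.1])) (hwlow s ⟨hs.1.le, hs.2.le⟩)
  have hG0 : 0 ≤ G := (norm_nonneg _).trans (hG c ⟨le_rfl, hcσ.le⟩)
  have hwc : Continuous w := continuous_iff_continuousAt.2 fun s => (hw s).continuousAt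
  -- the local field
  set A : ℝ → EuclideanSpace ℝ (Fin 3) →L[ℝ] EuclideanSpace ℝ (Fin 3) := fun s =>
    (w s)⁻¹ • (-((1 / 2 + w' s) • ContinuousLinearMap.id ℝ (EuclideanSpace ℝ (Fin 3))) - α • crossCLM e - (cst * m s) • crossCLM.flip d)
    with hA
  set b : ℝ → EuclideanSpace ℝ (Fin 3) := fun s => (w s)⁻¹ • g s with hb
  have hA_apply : ∀ s x, A s x = (w s)⁻¹ • (-((1 / 2 + w' s) • x) - α • cross e x - (cst * m s) • cross x d) :=
    fun s x => localField_apply w w' m α cst d e s x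
  -- continuity of the data away from the zeros of `w`
  have hA0c : Continuous fun s =>
      (-((1 / 2 + w' s) • ContinuousLinearMap.id ℝ (EuclideanSpace ℝ (Fin 3))) - α • crossCLM e - (cst * m s) • crossCLM.flip d) :=
    (((continuous_const.add hw'c).smul continuous_const).neg.sub continuous_const).sub
      ((continuous_const.mul hm).smul continuous_const)
  have hAcontAt : ∀ s, w s ≠ 0 → ContinuousAt A s := fun s hs =>
    ((hwc.continuousAt.inv₀ hs).smul hA0c.continuousAt)
  have hbcontAt : ∀ s, w s ≠ 0 → ContinuousAt b s := fun s hs =>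
    ((hwc.continuousAt.inv₀ hs).smul hg.continuousAt)
  have hAc : ContinuousOn A (Ioo c σ₂) := fun s hs => (hAcontAt s (hwpos s hs).ne').continuousWithinAt
  have hbc : ContinuousOn b (Ioo c σ₂) := fun s hs => (hbcontAt s (hwpos s hs).ne').continuousWithinAt
  -- the approximants: `φₙ(c + ηₙ) = 0`, `ηₙ = (σ₂ − c)/(n + 2)`
  set η : ℕ → ℝ := fun n => (σ₂ - c) / ((n : ℝ) + 2) with hη
  have hn2 : ∀ n : ℕ, (0 : ℝ) < (n : ℝ) + 2 := fun n => by positivity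
  have hηpos : ∀ n, 0 < η n := fun n => div_pos (by linarith) (hn2 n)
  have hηlt : ∀ n, η n < σ₂ - c := fun n => by
    rw [hη, div_lt_iff₀ (hn2 n)]; nlinarith
  have hηanti : ∀ {n k : ℕ}, n ≤ k → η k ≤ η n := fun {n k} hnk =>
    div_le_div_of_nonneg_left (by linarith) (hn2 n) (by exact_mod_cast Nat.add_le_add_right hnk 2)
  have hηmem : ∀ n, c + η n ∈ Ioo c σ₂ := fun n => ⟨by linarith [hηpos n], by linarith [hηlt n]⟩
  have hηtend : Tendsto η atTop (𝓝 0) := by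
    have h1 : Tendsto (fun n : ℕ => ((n : ℝ) + 2)⁻¹) atTop (𝓝 0) := by
      have := tendsto_inv_atTop_zero.comp
        (tendsto_atTop_add_const_right atTop (2 : ℝ) tendsto_natCast_atTop_atTop)
      exact this
    have h2 := h1.const_mul (σ₂ - c)
    rw [mul_zero] at h2
    refine h2.congr fun n => ?_
    simp only [hη, div_eq_mul_inv]
  have hex : ∀ n : ℕ, ∃ v : ℝ → EuclideanSpace ℝ (Fin 3), v (c + η n) = 0 ∧ ∀ t ∈ Ioo c σ₂, HasDerivAt v (A t (v t) + b t) t :=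
    fun n => exists_solution_affine_of_continuousOn_Ioo (hηmem n) hAc hbc 0
  choose φn hφn0 hφnd using hex
  -- the approximants solve the sourced equation on the open half-ball
  set F : ℕ → ℝ → EuclideanSpace ℝ (Fin 3) := fun n t => A t (φn n t) + b t with hF
  have hφn_eq : ∀ n, ∀ t ∈ Ioo c σ₂,
      w t • F n t + (1 / 2 : ℝ) • φn n t + w' t • φn n t + α • cross e (φn n t) + (cst * m t) • cross (φn n t) d = g t := by
    intro n t ht
    refine sourced_eq_of_deriv_eq (hwpos t ht).ne' ?_
    simp only [hF, hA_apply, hb]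
  -- a-priori bound: `w(s)‖φₙ(s)‖ ≤ G(s − c)` for `s ≥ c + ηₙ`
  have hIcc_sub : ∀ {a₁ b₁ : ℝ}, c < a₁ → b₁ < σ₂ → Icc a₁ b₁ ⊆ Ioo c σ₂ := fun ha hb x hx =>
    ⟨lt_of_lt_of_le ha hx.1, lt_of_le_of_lt hx.2 hb⟩
  have hbound : ∀ n, ∀ s ∈ Ioo c σ₂, c + η n ≤ s → w s * ‖φn n s‖ ≤ G * (s - c) := by
    intro n s hs hle
    have hsub := hIcc_sub (hηmem n).1 hs.2
    have h := wnorm_le_of_sourced_right (σ₀ := c + η n) (σ₁ := s) (φ := φn n) (φ' := F n) (G := G) hle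
      (fun x _ => hw x) (fun x hx => hφnd n x (hsub hx)) (fun x hx => (hwpos x (hsub hx)).le)
      (fun x hx => hG x ⟨(hsub hx).1.le, (hsub hx).2.le⟩) (fun x hx => hφn_eq n x (hsub hx))
    rw [hφn0 n, norm_zero, mul_zero, zero_add] at h
    have : G * (s - (c + η n)) ≤ G * (s - c) := mul_le_mul_of_nonneg_left (by linarith [hηpos n]) hG0
    exact h.trans this
  -- Cauchy estimate: `w(s)‖φₙ(s) − φₖ(s)‖ ≤ G ηₙ` for `k ≥ n`, `s ≥ c + ηₙ`
  have hcauchy : ∀ n k, n ≤ k → ∀ s ∈ Ioo c σ₂, c + η n ≤ s → w s * ‖φn n s - φn k s‖ ≤ G * η n := by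
    intro n k hnk s hs hle
    have hsub := hIcc_sub (hηmem n).1 hs.2
    have h := wnorm_le_of_sourced_right (σ₀ := c + η n) (σ₁ := s) (φ := fun t => φn n t - φn k t)
      (φ' := fun t => F n t - F k t) (g := fun _ => 0) (G := 0) (cst := cst) (α := α) (m := m) (d := d) (e := e) hle
      (fun x _ => hw x) (fun x hx => (hφnd n x (hsub hx)).sub (hφnd k x (hsub hx))) (fun x hx => (hwpos x (hsub hx)).le)
      (fun x _ => by simp) (fun x hx => homogeneous_of_sub (hφn_eq n x (hsub hx)) (hφn_eq k x (hsub hx)))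
    rw [zero_mul, add_zero] at h
    have hk : w (c + η n) * ‖φn n (c + η n) - φn k (c + η n)‖ ≤ G * η n := by
      rw [hφn0 n, zero_sub, norm_neg]
      have := hbound k (c + η n) (hηmem n) (by linarith [hηanti hnk])
      simpa using this
    exact h.trans hk
  have hcauchy' : ∀ n k, n ≤ k → ∀ s ∈ Ioo c σ₂, c + η n ≤ s → ‖φn n s - φn k s‖ ≤ G * η n / w s := by
    intro n k hnk s hs hle
    rw [le_div_iff₀ (hwpos s hs), mul_comm]
    exact hcauchy n k hnk s hs hle
  -- for every station an index beyond which `c + ηₙ ≤ s`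
  have hevent : ∀ s ∈ Ioo c σ₂, ∀ δ > 0, ∃ N : ℕ, ∀ n ≥ N, η n ≤ δ := by
    intro s _ δ hδ
    obtain ⟨N, hN⟩ := (Metric.tendsto_atTop.1 hηtend) δ hδ
    exact ⟨N, fun n hn => by
      have := hN n hn
      rw [Real.dist_eq, sub_zero, abs_of_pos (hηpos n)] at this
      exact this.le⟩
  -- the limit
  have hCauchySeq : ∀ s ∈ Ioo c σ₂, CauchySeq fun n => φn n s := by
    intro s hs
    refine Metric.cauchySeq_iff'.2 fun ε hε => ?_
    have hws := hwpos s hs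
    -- choose `N` with `ηₙ ≤ s − c` and `G ηₙ / w s < ε` for `n ≥ N`
    obtain ⟨N₁, hN₁⟩ := hevent s hs (s - c) (by linarith [hs.1])
    obtain ⟨N₂, hN₂⟩ := hevent s hs (ε * w s / (2 * (G + 1))) (by positivity)
    refine ⟨max N₁ N₂, fun n hn => ?_⟩
    have hn1 : N₁ ≤ n := le_trans (le_max_left _ _) hn
    have hN : c + η (max N₁ N₂) ≤ s := by linarith [hN₁ (max N₁ N₂) (le_max_left _ _)]
    rw [dist_eq_norm, norm_sub_rev]
    have h := hcauchy' (max N₁ N₂) n hn s hs hN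
    have hη2 := hN₂ (max N₁ N₂) (le_max_right _ _)
    calc ‖φn (max N₁ N₂) s - φn n s‖ ≤ G * η (max N₁ N₂) / w s := h
      _ ≤ G * (ε * w s / (2 * (G + 1))) / w s := by gcongr
      _ = ε * (G / (2 * (G + 1))) := by field_simp
      _ < ε := by
          have : G / (2 * (G + 1)) < 1 := by rw [div_lt_one (by positivity)]; linarith
          nlinarith
  set φ : ℝ → EuclideanSpace ℝ (Fin 3) := fun s => limUnder atTop fun n => φn n s with hφ
  have hlim : ∀ s ∈ Ioo c σ₂, Tendsto (fun n => φn n s) atTop (𝓝 (φ s)) := fun s hs => (hCauchySeq s hs).tendsto_limUnder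
  -- rate of convergence: `‖φₙ(s) − φ(s)‖ ≤ G ηₙ / w s` once `c + ηₙ ≤ s`
  have hrate : ∀ n, ∀ s ∈ Ioo c σ₂, c + η n ≤ s → ‖φn n s - φ s‖ ≤ G * η n / w s := by
    intro n s hs hle
    have ht : Tendsto (fun k => ‖φn n s - φn k s‖) atTop (𝓝 ‖φn n s - φ s‖) :=
      (tendsto_const_nhds.sub (hlim s hs)).norm
    exact le_of_tendsto ht (eventually_atTop.2 ⟨n, fun k hk => hcauchy' n k hk s hs hle⟩)
  -- waist-regular bound of the limit
  have hφbound : ∀ s ∈ Ioo c σ₂, w s * ‖φ s‖ ≤ G * (s - c) := by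
    intro s hs
    have ht : Tendsto (fun n => w s * ‖φn n s‖) atTop (𝓝 (w s * ‖φ s‖)) := (hlim s hs).norm.const_mul _
    obtain ⟨N, hN⟩ := hevent s hs (s - c) (by linarith [hs.1])
    exact le_of_tendsto ht (eventually_atTop.2 ⟨N, fun n hn => hbound n s hs (by linarith [hN n hn])⟩)
  have hφsup : ∀ s ∈ Ioo c σ₂, ‖φ s‖ ≤ G / κ₁ := by
    intro s hs
    have hws := hwpos s hs
    have h1 := hφbound s hs
    have h2 := hwlow s ⟨hs.1.le, hs.2.le⟩
    rw [le_div_iff₀ hκ₁]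
    have hsc : 0 < s - c := by linarith [hs.1]
    nlinarith [norm_nonneg (φ s), mul_le_mul_of_nonneg_right h2 (norm_nonneg (φ s))]
  -- the derivative of the limit
  have hderiv : ∀ s₀ ∈ Ioo c σ₂, HasDerivAt φ (A s₀ (φ s₀) + b s₀) s₀ := by
    intro s₀ hs₀
    set δ : ℝ := (s₀ - c) / 2 with hδ
    have hδ0 : 0 < δ := by rw [hδ]; linarith [hs₀.1]
    set U : Set ℝ := Ioo (c + δ) σ₂ with hU
    have hUsub : U ⊆ Ioo c σ₂ := fun x hx => ⟨by linarith [hx.1], hx.2⟩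
    have hs₀U : s₀ ∈ U := ⟨by rw [hδ]; linarith [hs₀.1], hs₀.2⟩
    -- a bound for `‖A‖` on the closure `[c + δ, σ₂]`
    have hAK : ContinuousOn A (Icc (c + δ) σ₂) := fun x hx =>
      (hAcontAt x (lt_of_lt_of_le (mul_pos hκ₁ (by linarith [hx.1])) (hwlow x ⟨by linarith [hx.1], hx.2⟩)).ne').continuousWithinAt
    obtain ⟨KA, hKA⟩ := (isCompact_Icc (a := c + δ) (b := σ₂)).exists_bound_of_continuousOn hAK
    have hKA0 : 0 ≤ KA := (norm_nonneg _).trans (hKA (c + δ) ⟨le_rfl, by rw [hδ]; linarith [hs₀.1, hs₀.2]⟩)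
    obtain ⟨N₀, hN₀⟩ := hevent s₀ hs₀ δ hδ0
    -- uniform convergence of the derivatives on `U`
    have hunif : TendstoUniformlyOn F (fun t => A t (φ t) + b t) atTop U := by
      refine Metric.tendstoUniformlyOn_iff.2 fun ε hε => ?_
      obtain ⟨N₁, hN₁⟩ := hevent s₀ hs₀ (ε * (κ₁ * δ) / (2 * (KA * G + 1))) (by positivity)
      refine eventually_atTop.2 ⟨max N₀ N₁, fun n hn x hx => ?_⟩
      have hxI : x ∈ Ioo c σ₂ := hUsub hx
      have hηn : η n ≤ δ := hN₀ n (le_trans (le_max_left _ _) hn)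
      have hle : c + η n ≤ x := by linarith [hx.1]
      have hwx : κ₁ * δ ≤ w x := le_trans (mul_le_mul_of_nonneg_left (by linarith [hx.1]) hκ₁.le) (hwlow x ⟨hxI.1.le, hxI.2.le⟩)
      have hkδ : 0 < κ₁ * δ := mul_pos hκ₁ hδ0
      rw [dist_eq_norm]
      have hdiff : A x (φ x) + b x - F n x = A x (φ x - φn n x) := by
        simp only [hF, map_sub]; abel
      rw [hdiff]
      have hr := hrate n x hxI hle
      calc ‖A x (φ x - φn n x)‖ ≤ ‖A x‖ * ‖φ x - φn n x‖ := (A x).le_opNorm _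
        _ ≤ KA * (G * η n / w x) := by
            rw [norm_sub_rev]
            exact mul_le_mul (hKA x ⟨hx.1.le, hx.2.le⟩) hr (norm_nonneg _) hKA0
        _ ≤ KA * (G * η n / (κ₁ * δ)) := by gcongr
        _ ≤ KA * (G * (ε * (κ₁ * δ) / (2 * (KA * G + 1))) / (κ₁ * δ)) := by
            gcongr
            exact hN₁ n (le_trans (le_max_right _ _) hn)
        _ = ε * (KA * G / (2 * (KA * G + 1))) := by field_simp
        _ < ε := by
            have : KA * G / (2 * (KA * G + 1)) < 1 := by
              rw [div_lt_one (by positivity)]; nlinarith [mul_nonneg hKA0 hG0]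
            nlinarith
    have hFder : ∀ᶠ n in atTop, ∀ x ∈ U, HasDerivAt (φn n) (F n x) x :=
      Eventually.of_forall fun n x hx => hφnd n x (hUsub hx)
    exact hasDerivAt_of_tendstoUniformlyOn isOpen_Ioo hunif hFder (fun x hx => hlim x (hUsub hx)) hs₀U
  -- assemble
  refine ⟨φ, fun s => A s (φ s) + b s, hderiv, fun s hs => ?_, hφbound, hφsup⟩
  refine sourced_eq_of_deriv_eq (hwpos s hs).ne' ?_
  simp only [hA_apply, hb]

/-! ## §4 Left of the waist, by reflection -/

/-- **EXISTENCE OF THE BOUNDED WAIST-REGULAR BRANCH (left half-ball).**  Mirror of `exists_waistRegular_branch_right`: if the slip opens at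
least linearly to the LEFT of the stagnation point, `κ₁(c − s) ≤ −w(s)` on `[σ₁, c]` (`κ₁ > 0`, `σ₁ < c`), the sourced local adjoint equation has
a solution on `(σ₁, c)`, differentiable there, with `|w(s)|‖φ(s)‖ ≤ G(c − s)` and `‖φ(s)‖ ≤ G/κ₁`.  Proof: the reflection `s ↦ 2c − s` with
`w ↦ −w(2c − ·)` (whose derivative is `w′(2c − ·)`) maps the left problem onto a right problem of the same form. [folklore] -/
theorem exists_waistRegular_branch_left {σ₁ c κ₁ G α cst : ℝ} {m w w' : ℝ → ℝ} {g : ℝ → EuclideanSpace ℝ (Fin 3)}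
    {d e : EuclideanSpace ℝ (Fin 3)} (hσc : σ₁ < c) (hκ₁ : 0 < κ₁)
    (hw : ∀ s, HasDerivAt w (w' s) s) (hw'c : Continuous w') (hm : Continuous m) (hg : Continuous g)
    (hwlow : ∀ s ∈ Icc σ₁ c, κ₁ * (c - s) ≤ -w s) (hG : ∀ s ∈ Icc σ₁ c, ‖g s‖ ≤ G) :
    ∃ φ φ' : ℝ → EuclideanSpace ℝ (Fin 3),
      (∀ s ∈ Ioo σ₁ c, HasDerivAt φ (φ' s) s) ∧
      (∀ s ∈ Ioo σ₁ c, w s • φ' s + (1 / 2 : ℝ) • φ s + w' s • φ s + α • cross e (φ s) + (cst * m s) • cross (φ s) d = g s) ∧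
      (∀ s ∈ Ioo σ₁ c, -w s * ‖φ s‖ ≤ G * (c - s)) ∧
      (∀ s ∈ Ioo σ₁ c, ‖φ s‖ ≤ G / κ₁) := by
  -- the reflection and the reflected slip
  have hr : ∀ s, HasDerivAt (fun s : ℝ => 2 * c - s) (-1) s := fun s => (hasDerivAt_id' s).const_sub (2 * c)
  have hwr : ∀ s, HasDerivAt (fun s => -w (2 * c - s)) (w' (2 * c - s)) s := fun s => by
    have h := ((hw (2 * c - s)).scomp s (hr s)).neg
    simp only [smul_eq_mul, neg_mul, one_mul, neg_neg] at h
    exact h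
  have hrc : Continuous fun s : ℝ => 2 * c - s := continuous_const.sub continuous_id
  obtain ⟨ψ, ψ', hψd, hψeq, hψb, hψs⟩ := exists_waistRegular_branch_right (c := c) (σ₂ := 2 * c - σ₁) (κ₁ := κ₁) (G := G) (α := α)
    (cst := cst) (m := fun s => m (2 * c - s)) (w := fun s => -w (2 * c - s)) (w' := fun s => w' (2 * c - s))
    (g := fun s => g (2 * c - s)) (d := d) (e := e) (by linarith) hκ₁ hwr (hw'c.comp hrc) (hm.comp hrc) (hg.comp hrc)
    (fun s hs => by have := hwlow (2 * c - s) ⟨by linarith [hs.2], by linarith [hs.1]⟩; linarith)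
    (fun s hs => hG (2 * c - s) ⟨by linarith [hs.2], by linarith [hs.1]⟩)
  have hmem : ∀ s ∈ Ioo σ₁ c, 2 * c - s ∈ Ioo c (2 * c - σ₁) := fun s hs => ⟨by linarith [hs.2], by linarith [hs.1]⟩
  refine ⟨fun s => ψ (2 * c - s), fun s => -ψ' (2 * c - s), fun s hs => ?_, fun s hs => ?_, fun s hs => ?_, fun s hs => hψs _ (hmem s hs)⟩
  · have h := (hψd (2 * c - s) (hmem s hs)).scomp s (hr s)
    simp only [neg_smul, one_smul] at h
    exact h
  · have h := hψeq (2 * c - s) (hmem s hs)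
    simp only [sub_sub_cancel] at h
    rw [smul_neg, ← neg_smul]
    exact h
  · have h := hψb (2 * c - s) (hmem s hs)
    simp only [sub_sub_cancel] at h
    have e1 : 2 * c - s - c = c - s := by ring
    rw [e1] at h
    exact h

end Summit.NavierStokesRegularity.NavierStokesRegularity.Theorems.Clause13RAdjointWaistExistence

end
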